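/-
Copyright (c) 2026. All rights reserved.
Released under Apache 2.0 license as described in the file LICENSE.
-/
import Literature.NumberTheory.Automorphic.EichlerOrderAutomorphisms
import HarnessLib

/-!
# Reduced norms on the normaliser of an Eichler order: `v_r(nrd x) ≡ [r ∈ supp x] · v_r(localNorm r) (mod 2)`, and for
# squarefree level `supp x = {r : v_r(nrd x) odd}`, `x ∈ ℚ^×O^× ⟺ nrd x ∈ ℚ^{×2}` (Voight Lemma 18.5.1, Prop. 18.5.3, 23.4.14)

[tag: quaternion_algebra] [tag: eichler_order] [tag: class_number]

Topic `NumberTheory/Automorphic`; THEOREMS ONLY (no definition, no named fact, no instance, no notation; net debt `0`).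
Lane `lit-hodgefound`, seat p12, gen 54 — for the Eichler order `O` of a Brandt setup `S : XiSetup N⁺ N⁻` (definite quaternion
algebra `D` over `ℚ` of discriminant `N⁻`, Eichler order of level `N⁺`), on top of `EichlerOrderTwoSidedIdealsNormaliser.lean`
(every `x ∈ N(O)` has support data `O P_l(O) = (q x) O`, and the generator `y = q x` has `nrd y = ∏_{r ∈ l} localNorm r`),
`BrandtSetupTwoSidedIdealNorms.lean` (`v_r(∏ localNorm) = [r ∈ l] a_r`) and `EichlerOrderAutomorphisms.lean` (inner ⟺ `ℚ^×O^×`).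

THE PRINTED STATEMENTS (J. Voight, *Quaternion Algebras*, GTM 288). **Lemma 18.5.1** (`N(O) → PIdl(O)`, `α ↦ OαO`);
**Prop. 18.5.3** (`N(O)/(F^×O^×) ≅ PIdl(O)/PIdl(R)`); **23.3.19** (`P = Oπ`, `nrd(P) = 𝔭`) and **Prop. 23.4.14** (`𝔔 = Oϖ`,
`ϖ² = π^e`, so `nrd ϖ ∈ π^e R_𝔭^×`): the reduced norm of a generator of `∏_{𝔭 ∈ s} T_𝔭` has valuation `a_𝔭 = 1` (ramified) resp.
`e = v_𝔭(𝔐)` (level) at `𝔭 ∈ s` and `0` elsewhere, up to squares of `F^×`. Consequently the class of `α ∈ N(O)` modulo `F^×O^×`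
is detected by the parities of `v_𝔭(nrd α)` at the primes with odd `a_𝔭` — at all primes of `𝔑` when the level is squarefree.

With support data `(l, q, y)` of `x` — `l` a duplicate-free list of primes, `q ∈ ℚ^×`, `y = q x`, `O P_l(O) = yO` — and
`a_r := 1` if `r ∣ N⁻`, `v_r(N⁺)` otherwise (`= v_r(localNorm r)`), this file proves:

* §1 **`v_r(nrd x) + 2 v_r(q) = [r ∈ l] · a_r`** at every prime `r` (`XiSetup.padicValRat_reducedNorm_add_two_mul_eq`); hence
  **`v_r(nrd x)` is even iff `r ∉ l` or `a_r` is even**, and **for odd `a_r` (ramified `r`, or odd `v_r(N⁺)`): `r ∈ l ⟺ v_r(nrd x)`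
  odd** (`XiSetup.mem_support_iff_odd_padicValRat`);
* §2 **empty support ⟹ `nrd x ∈ ℚ^{×2}`** (`O = yO` forces `nrd y = 1`, `nrd x = q⁻²`), in particular **`nrd(ℚ^× O^×) ⊆ ℚ^{×2}`**
  and **inner automorphisms have conjugators of square reduced norm**;
* §3 **SQUAREFREE LEVEL `N⁺`** (`a_r = 1` at every prime of `N⁺N⁻`): **`r ∈ l ⟺ v_r(nrd x)` odd at EVERY prime**
  (`XiSetup.mem_support_iff_odd_padicValRat_of_squarefree` — the support of `x ∈ N(O)` is read off from `nrd x`), **`l = [] ⟺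
  nrd x ∈ ℚ^{×2}`**, **`x ∈ ℚ^×O^× ⟺ nrd x ∈ ℚ^{×2}`** for `x ∈ N(O)` (`XiSetup.exists_stabilizer_iff_isSquare_reducedNorm_of_squarefree`),
  and **an automorphism of `O` is inner iff its conjugator has square reduced norm**
  (`XiSetup.inner_iff_isSquare_reducedNorm_of_squarefree`).

## References

* [Voight2021] J. Voight, *Quaternion Algebras*, GTM 288 (2021): Lemma 18.5.1, Prop. 18.5.3, Remark 18.5.6, 23.3.19,
  Prop. 23.4.14, (23.4.20).
* [VignerasLNM800] M.-F. Vignéras, *Arithmétique des algèbres de quaternions*, LNM 800 (1980), Ch. II §1 Cor. 1.7, Ch. II §2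
  (normalisateur d'un ordre d'Eichler), Ch. III §5 exercice 5.8.

## Scope (honest)

Theorems only. At a level prime with even `v_r(N⁺) ≥ 2` the reduced norm does NOT detect membership of `r` in the support
(`nrd ϖ = p^e` is a square up to units); §3 therefore assumes `N⁺` squarefree.
-/

noncomputable section

open scoped Pointwise

universe u

namespace Literature.NumberTheory.Automorphic

open AtkinLehner

namespace Brandt

variable {Nplus Nminus : ℕ} (S : XiSetup Nplus Nminus)

/-! ## §0 Elementary lemmas -/

/-- The reduced norm of a unit is non-zero. [folklore] -/
private theorem XiSetup.reducedNorm_units_ne_zero₆₅ (u : S.Dˣ) : reducedNorm ℚ S.D (u : S.D) ≠ 0 :=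
  (isUnit_iff_reducedNorm_ne_zero_holds ℚ S.D (u : S.D)).mp u.isUnit

/-- A unit of `O` (an element of the stabiliser of `O`) has reduced norm `1` (definite algebra). [cite: VignerasLNM800, Ch. I §4 Lemme 4.12] -/
private theorem XiSetup.reducedNorm_eq_one_of_mem_stabilizer₆₅ {y : S.Dˣ} (hy : y ∈ MulAction.stabilizer S.Dˣ S.O) :
    reducedNorm ℚ S.D (y : S.D) = 1 := by
  obtain ⟨h1, h2⟩ := mem_stabilizer_submodule_iff.mp hy
  rw [S.isZOrder_O.leftOrderOf_eq] at h1 h2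
  exact (S.isEichlerOrder.isOrder.exists_inv_mem_iff_of_isTotallyDefinite S.isTotallyDefinite h1).mp ⟨_, h2, y.mul_inv, y.inv_mul⟩

/-- `nrd(q x) = q² nrd x`. [folklore] -/
private theorem reducedNorm_algebraMap_mul₆₅ {D : Type u} [Ring D] [Algebra ℚ D] [IsQuaternionAlgebra ℚ D] (q : ℚ) (x : D) :
    reducedNorm ℚ D (algebraMap ℚ D q * x) = q ^ 2 * reducedNorm ℚ D x := by
  rw [reducedNorm_mul_holds ℚ D, reducedNorm_algebraMap_rat]

/-- At a prime of a squarefree `N⁺N⁻`-datum the exponent `a_r` is `1`: `r ∣ N⁺N⁻`, `N⁺` squarefree ⟹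
`(if r ∣ N⁻ then 1 else v_r(N⁺)) = 1`. [folklore] -/
private theorem exponent_eq_one_of_squarefree₆₅ (hN : Squarefree Nplus) {r : ℕ} (hr : r.Prime) (hrN : r ∣ Nplus * Nminus) :
    (if r ∣ Nminus then 1 else Nplus.factorization r) = 1 := by
  by_cases hm : r ∣ Nminus
  · rw [if_pos hm]
  · rw [if_neg hm]
    have hrNp : r ∣ Nplus := ((Nat.Prime.dvd_mul hr).mp hrN).resolve_right hm
    exact le_antisymm ((Nat.squarefree_iff_factorization_le_one hN.ne_zero).mp hN r)
      (hr.factorization_pos_of_dvd hN.ne_zero hrNp)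

/-! ## §1 The valuations of `nrd x` for `x` with support data `O P_l(O) = (q x) O` -/

/-- **`v_r(nrd x) + 2 v_r(q) = [r ∈ l] · a_r`**: if `O P_l(O) = yO` with `y = q x` (`l` a duplicate-free list of primes, `q ≠ 0`)
then at every prime `r`, `v_r(nrd x) + 2 v_r(q) = a_r` if `r ∈ l` (`a_r = 1` for `r ∣ N⁻`, `v_r(N⁺)` otherwise) and `= 0` if
`r ∉ l` (`nrd y = ∏_{r ∈ l} localNorm r`, `nrd y = q² nrd x`). [cite: Voight2021, Lemma 18.5.1 with 23.3.19 and Prop. 23.4.14] -/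
theorem XiSetup.padicValRat_reducedNorm_add_two_mul_eq {l : List ℕ} (hl : ∀ r ∈ l, r.Prime) (hnd : l.Nodup) {x y : S.Dˣ}
    {q : ℚ} (hq : q ≠ 0) (hy : (y : S.D) = algebraMap ℚ S.D q * x) (h : S.O * S.twoSidedIdealProd S.O l = y • S.O)
    {r : ℕ} (hr : r.Prime) :
    padicValRat r (reducedNorm ℚ S.D (x : S.D)) + 2 * padicValRat r q =
      ((if r ∈ l then (if r ∣ Nminus then 1 else Nplus.factorization r) else 0 : ℕ) : ℤ) := by
  haveI : Fact r.Prime := ⟨hr⟩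
  have hn := S.reducedNorm_eq_of_order_mul_twoSidedIdealProd_eq_units_smul hl hnd h
  rw [hy, reducedNorm_algebraMap_mul₆₅] at hn
  have hv := congrArg (padicValRat r) hn
  rw [padicValRat.mul (pow_ne_zero 2 hq) (S.reducedNorm_units_ne_zero₆₅ x), pow_two, padicValRat.mul hq hq, padicValRat.of_nat,
    padicValNat_prod_localNorm hl hnd hr] at hv
  linarith

/-- **`v_r(nrd x)` is even iff `r ∉ l` or `a_r` is even.** [cite: Voight2021, Lemma 18.5.1 with 23.3.19 and Prop. 23.4.14] -/
theorem XiSetup.even_padicValRat_reducedNorm_iff {l : List ℕ} (hl : ∀ r ∈ l, r.Prime) (hnd : l.Nodup) {x y : S.Dˣ} {q : ℚ}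
    (hq : q ≠ 0) (hy : (y : S.D) = algebraMap ℚ S.D q * x) (h : S.O * S.twoSidedIdealProd S.O l = y • S.O) {r : ℕ} (hr : r.Prime) :
    Even (padicValRat r (reducedNorm ℚ S.D (x : S.D))) ↔ r ∉ l ∨ Even (if r ∣ Nminus then 1 else Nplus.factorization r) := by
  have key := S.padicValRat_reducedNorm_add_two_mul_eq hl hnd hq hy h hr
  have e : padicValRat r (reducedNorm ℚ S.D (x : S.D)) =
      ((if r ∈ l then (if r ∣ Nminus then 1 else Nplus.factorization r) else 0 : ℕ) : ℤ) - 2 * padicValRat r q := by linarith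
  rw [e, Int.even_sub]
  by_cases hm : r ∈ l
  · rw [if_pos hm]
    simp only [hm, not_true_eq_false, false_or, even_two_mul, iff_true, Int.even_coe_nat]
  · rw [if_neg hm]
    simp [hm]

/-- **For a prime `r` with ODD `a_r` (every ramified `r ∣ N⁻`, or `r ∤ N⁻` with `v_r(N⁺)` odd): `r ∈ l ⟺ v_r(nrd x)` is odd** —
membership of `r` in the support of `x` is read off from `nrd x`. [cite: Voight2021, Lemma 18.5.1, Prop. 18.5.3 with 23.3.19 and Prop. 23.4.14] -/
theorem XiSetup.mem_support_iff_odd_padicValRat {l : List ℕ} (hl : ∀ r ∈ l, r.Prime) (hnd : l.Nodup) {x y : S.Dˣ} {q : ℚ}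
    (hq : q ≠ 0) (hy : (y : S.D) = algebraMap ℚ S.D q * x) (h : S.O * S.twoSidedIdealProd S.O l = y • S.O) {r : ℕ} (hr : r.Prime)
    (ha : Odd (if r ∣ Nminus then 1 else Nplus.factorization r)) :
    r ∈ l ↔ Odd (padicValRat r (reducedNorm ℚ S.D (x : S.D))) := by
  rw [← Int.not_even_iff_odd, S.even_padicValRat_reducedNorm_iff hl hnd hq hy h hr, not_or, not_not]
  exact ⟨fun hm => ⟨hm, Nat.not_even_iff_odd.mpr ha⟩, fun hm => hm.1⟩

/-- **At a ramified prime `r ∣ N⁻`: `r ∈ l ⟺ v_r(nrd x)` odd** (`nrd 𝔓_r = r`). [cite: Voight2021, Lemma 18.5.1 with 23.3.19] -/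
theorem XiSetup.mem_support_iff_odd_padicValRat_of_dvd {l : List ℕ} (hl : ∀ r ∈ l, r.Prime) (hnd : l.Nodup) {x y : S.Dˣ}
    {q : ℚ} (hq : q ≠ 0) (hy : (y : S.D) = algebraMap ℚ S.D q * x) (h : S.O * S.twoSidedIdealProd S.O l = y • S.O) {r : ℕ}
    (hr : r.Prime) (hrm : r ∣ Nminus) : r ∈ l ↔ Odd (padicValRat r (reducedNorm ℚ S.D (x : S.D))) :=
  S.mem_support_iff_odd_padicValRat hl hnd hq hy h hr (by rw [if_pos hrm]; exact odd_one)

/-! ## §2 Empty support forces a square reduced norm -/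

/-- **Empty support ⟹ `nrd x ∈ ℚ^{×2}`**: if `O P_{[]}(O) = O = yO` with `y = q x` then `nrd y = 1` and `nrd x = (q⁻¹)²`.
[cite: Voight2021, Lemma 18.5.1 and Prop. 18.5.3] [cite: VignerasLNM800, Ch. I §4 Lemme 4.12] -/
theorem XiSetup.isSquare_reducedNorm_of_support_nil {x y : S.Dˣ} {q : ℚ} (hq : q ≠ 0) (hy : (y : S.D) = algebraMap ℚ S.D q * x)
    (h : S.O * S.twoSidedIdealProd S.O [] = y • S.O) : IsSquare (reducedNorm ℚ S.D (x : S.D)) := by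
  have hstab : y ∈ MulAction.stabilizer S.Dˣ S.O := (S.order_mul_twoSidedIdealProd_nil_eq_units_smul_iff y).mp h
  have h1 := S.reducedNorm_eq_one_of_mem_stabilizer₆₅ hstab
  rw [hy, reducedNorm_algebraMap_mul₆₅] at h1
  refine ⟨q⁻¹, ?_⟩
  have hq2 : q ^ 2 ≠ 0 := pow_ne_zero 2 hq
  field_simp
  linear_combination h1

/-- **`nrd(ℚ^× O^×) ⊆ ℚ^{×2}`: if a non-zero rational multiple `q x` of `x` is a unit of `O` then `nrd x` is a square.**
[cite: Voight2021, Prop. 18.5.3] [cite: VignerasLNM800, Ch. I §4 Lemme 4.12] -/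
theorem XiSetup.isSquare_reducedNorm_of_exists_stabilizer {x : S.Dˣ}
    (hx : ∃ q : ℚ, 0 < q ∧ ∃ y ∈ MulAction.stabilizer S.Dˣ S.O, (y : S.D) = algebraMap ℚ S.D q * x) :
    IsSquare (reducedNorm ℚ S.D (x : S.D)) := by
  obtain ⟨q, hq, y, hy, hyq⟩ := hx
  exact S.isSquare_reducedNorm_of_support_nil hq.ne' hyq ((S.order_mul_twoSidedIdealProd_nil_eq_units_smul_iff y).mpr hy)

/-- **Inner automorphisms have conjugators of square reduced norm**: if `σ = u · u⁻¹` agrees with conjugation by a unit of `O`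
then `nrd u ∈ ℚ^{×2}`. [cite: Voight2021, Remark 18.5.6 and Prop. 18.5.3] -/
theorem XiSetup.isSquare_reducedNorm_of_inner {u : S.Dˣ}
    (hinner : ∃ w ∈ MulAction.stabilizer S.Dˣ S.O, ∀ a : S.D, (w : S.D) * a * ((w⁻¹ : S.Dˣ) : S.D) = u * a * ((u⁻¹ : S.Dˣ) : S.D)) :
    IsSquare (reducedNorm ℚ S.D (u : S.D)) :=
  S.isSquare_reducedNorm_of_exists_stabilizer ((S.exists_stabilizer_conj_eq_iff u).mp hinner)

/-! ## §3 Squarefree level: the support is the set of primes of odd valuation -/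

/-- **SQUAREFREE LEVEL: `r ∈ l ⟺ v_r(nrd x)` is odd, at EVERY prime `r`** — for `N⁺` squarefree and support data
`O P_l(O) = (q x) O` with `l` a duplicate-free list of primes of `N⁺N⁻`, the support of `x` is exactly the set of primes at
which `nrd x` has odd valuation. [cite: Voight2021, Lemma 18.5.1, Prop. 18.5.3 with 23.3.19 and Prop. 23.4.14] -/
theorem XiSetup.mem_support_iff_odd_padicValRat_of_squarefree (hN : Squarefree Nplus) {l : List ℕ}
    (hl : ∀ r ∈ l, r.Prime ∧ r ∣ Nplus * Nminus) (hnd : l.Nodup) {x y : S.Dˣ} {q : ℚ} (hq : q ≠ 0)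
    (hy : (y : S.D) = algebraMap ℚ S.D q * x) (h : S.O * S.twoSidedIdealProd S.O l = y • S.O) {r : ℕ} (hr : r.Prime) :
    r ∈ l ↔ Odd (padicValRat r (reducedNorm ℚ S.D (x : S.D))) := by
  have hl' : ∀ r ∈ l, r.Prime := fun r h => (hl r h).1
  by_cases ha : Odd (if r ∣ Nminus then 1 else Nplus.factorization r)
  · exact S.mem_support_iff_odd_padicValRat hl' hnd hq hy h hr ha
  · -- then `r ∉ l` (at `r ∈ l` the exponent is `1`), and `v_r(nrd x) = -2 v_r(q)` is even
    have hm : r ∉ l := fun hm => ha (by rw [exponent_eq_one_of_squarefree₆₅ hN hr (hl r hm).2]; exact odd_one)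
    refine iff_of_false hm fun hodd => ?_
    have heven := (S.even_padicValRat_reducedNorm_iff hl' hnd hq hy h hr).mpr (Or.inl hm)
    exact (Int.not_even_iff_odd.mpr hodd) heven

/-- **SQUAREFREE LEVEL: the support is empty iff `nrd x ∈ ℚ^{×2}`.** [cite: Voight2021, Prop. 18.5.3 with 23.3.19 and Prop. 23.4.14] -/
theorem XiSetup.support_eq_nil_iff_isSquare_reducedNorm_of_squarefree (hN : Squarefree Nplus) {l : List ℕ}
    (hl : ∀ r ∈ l, r.Prime ∧ r ∣ Nplus * Nminus) (hnd : l.Nodup) {x y : S.Dˣ} {q : ℚ} (hq : q ≠ 0)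
    (hy : (y : S.D) = algebraMap ℚ S.D q * x) (h : S.O * S.twoSidedIdealProd S.O l = y • S.O) :
    l = [] ↔ IsSquare (reducedNorm ℚ S.D (x : S.D)) := by
  constructor
  · rintro rfl
    exact S.isSquare_reducedNorm_of_support_nil hq hy h
  · rintro ⟨m, hm⟩
    have hm0 : m ≠ 0 := fun h0 => S.reducedNorm_units_ne_zero₆₅ x (by rw [hm, h0, mul_zero])
    refine List.eq_nil_iff_forall_not_mem.mpr fun r hr => ?_
    haveI : Fact r.Prime := ⟨(hl r hr).1⟩
    have hodd := (S.mem_support_iff_odd_padicValRat_of_squarefree hN hl hnd hq hy h (hl r hr).1).mp hr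
    rw [hm, padicValRat.mul hm0 hm0, ← two_mul] at hodd
    exact Int.not_even_iff_odd.mpr hodd (even_two_mul _)

/-- **SQUAREFREE LEVEL: `x ∈ ℚ^× O^× ⟺ nrd x ∈ ℚ^{×2}` for `x ∈ N(O)`** — the class of `x` in `N(O)/ℚ^×O^× ↪ ∏_{p ∣ N} ℤ/2ℤ` is
trivial iff its reduced norm is a rational square. [cite: Voight2021, Lemma 18.5.1 and Prop. 18.5.3] -/
theorem XiSetup.exists_stabilizer_iff_isSquare_reducedNorm_of_squarefree (hN : Squarefree Nplus) {x : S.Dˣ}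
    (hx : x • (MulOpposite.op ((x⁻¹ : S.Dˣ) : S.D) • S.O) = S.O) :
    (∃ q : ℚ, 0 < q ∧ ∃ y ∈ MulAction.stabilizer S.Dˣ S.O, (y : S.D) = algebraMap ℚ S.D q * x) ↔
      IsSquare (reducedNorm ℚ S.D (x : S.D)) := by
  refine ⟨S.isSquare_reducedNorm_of_exists_stabilizer, fun hsq => ?_⟩
  obtain ⟨l, hnd, hl, q, y, hq, hy, h⟩ := S.exists_order_mul_twoSidedIdealProd_eq_units_smul_of_conj_eq hx
  obtain rfl := (S.support_eq_nil_iff_isSquare_reducedNorm_of_squarefree hN hl hnd hq.ne' hy h).mpr hsq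
  exact ⟨q, hq, y, (S.order_mul_twoSidedIdealProd_nil_eq_units_smul_iff y).mp h, hy⟩

/-- **SQUAREFREE LEVEL: an automorphism of `O` is inner iff its conjugator has square reduced norm** — for `σ` with
`σ(a) ∈ O ⟺ a ∈ O` and `σ = u · u⁻¹`: `σ` is conjugation by a unit of `O` iff `nrd u ∈ ℚ^{×2}`. [cite: Voight2021, Remark 18.5.6, Prop. 18.5.3 and Cor. 7.7.4] -/
theorem XiSetup.inner_iff_isSquare_reducedNorm_of_squarefree (hN : Squarefree Nplus) {σ : S.D →ₐ[ℚ] S.D}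
    (hσ : ∀ a, σ a ∈ S.O ↔ a ∈ S.O) {u : S.Dˣ} (hσu : ∀ a : S.D, σ a = u * a * ((u⁻¹ : S.Dˣ) : S.D)) :
    (∃ w ∈ MulAction.stabilizer S.Dˣ S.O, ∀ a : S.D, σ a = (w : S.D) * a * ((w⁻¹ : S.Dˣ) : S.D)) ↔
      IsSquare (reducedNorm ℚ S.D (u : S.D)) := by
  -- `u` normalises `O`
  obtain ⟨v, hv, hσv⟩ := S.exists_conj_eq_and_forall_eq_conj_of_forall_mem_iff σ hσ
  obtain ⟨c, hc, huc⟩ := S.exists_eq_algebraMap_mul_of_forall_conj_eq (u := u) (v := v) fun a _ => by rw [← hσu a, hσv a]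
  have hsq_iff : IsSquare (reducedNorm ℚ S.D (u : S.D)) ↔ IsSquare (reducedNorm ℚ S.D (v : S.D)) := by
    rw [huc, reducedNorm_algebraMap_mul₆₅]
    constructor
    · rintro ⟨m, hm⟩
      exact ⟨m / c, by field_simp; linear_combination hm⟩
    · rintro ⟨m, hm⟩
      exact ⟨c * m, by rw [hm]; ring⟩
  rw [hsq_iff, ← S.exists_stabilizer_iff_isSquare_reducedNorm_of_squarefree hN hv, ← S.exists_stabilizer_conj_eq_iff v]
  constructor
  · rintro ⟨w, hw, hσw⟩
    exact ⟨w, hw, fun a => by rw [← hσw a, hσv a]⟩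
  · rintro ⟨w, hw, hwv⟩
    exact ⟨w, hw, fun a => by rw [hσv a, hwv a]⟩

end Brandt

end Literature.NumberTheory.Automorphic
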